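import Mathlib.LinearAlgebra.TensorPower.Basic
import Mathlib.Algebra.Module.Submodule.Bilinear
import Literature.AlgebraicGeometry.Motives.HodgeStructureAbelianTypeTensorPower
import Literature.AlgebraicGeometry.Motives.MumfordTateInvariantsTensorPairing
import HarnessLib

/-!
# Morphisms of tensor products of Hodge structures: `f ⊗ g`, twists, `H^{⊗ a} ⊗ H^{⊗ b} ≅ H^{⊗ (a+b)}`

Family `hodge`, layer `Literature/AlgebraicGeometry/Motives`. THEOREMS plus the plumbing
definitions they need (morphisms of Hodge structures with bodies); no named fact is introduced
(net debt 0). Sequel of `Motives/HodgeStructureAbelianTypeTensorPower` (Deligne's filtration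
`piTensorFiltration` on a tensor power of a filtered module, `f ↦ f^{⊗ k}`, the flattening
`H^{⊗ km} ≅ (H^{⊗ m})^{⊗ k}`); this file is the BINARY companion: the tensor product
`H₁ ⊗ H₂` of the tree (`HodgeStructure.tensor`, filtration `HodgeStructure.tensorFiltration`,
Deligne, Hodge II, 1.1.12) is functorial in morphisms of Hodge structures, commutes with Tate
twists, and `H^{⊗ a} ⊗ H^{⊗ b} ≅ H^{⊗ (a + b)}` is an isomorphism of Hodge structures. These are
the tools behind the closure of Hodge structures of abelian type under `⊗` and `⊕`
(`Motives/HodgeStructureAbelianTypeTensor`, `Motives/HodgeStructureAbelianTypeDirectSum`).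

Sources read verbatim. P. Deligne, *Théorie de Hodge II* [DeligneHodgeII1971], 1.1.12: the
filtration of a tensor product of filtered objects, `Fᵖ(A ⊗ B) = Σ_{a + b = p} Fᵃ A ⊗ Fᵇ B`
(for decreasing filtrations the same as `Σ_{a + b ≥ p}`), "`⊗` est un foncteur … de la catégorie
des objets filtrés", and 2.1.13–2.1.14 (the Tate twist `H(c) = H ⊗ ℚ(c)`). B. Moonen, *Families of
motives and the Mumford–Tate conjecture* [Moonen2017FamiliesMotives] (held text
`paper:doi-10-1007-s00032-017-0273-x`, p. 3), §2.1: "This category `HS_ℚ` is a neutral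
Tannakian category; in particular we have direct sums, tensor products and duals; on the
underlying `ℚ`-vector spaces they are given by the usual constructions." C. Voisin, *Hodge Theory
and Complex Algebraic Geometry I* [VoisinHodgeI2002], §7.3.1 Def. 7.22 (morphisms of Hodge
structures: `φ_ℂ(Fᵖ V_ℂ) ⊆ Fᵖ W_ℂ`) and §11.3.3 Def. 11.39 (tensor product of Hodge structures).

## What is proved

Multilinear algebra over a commutative ring `R` (modules `Y₁`, `Y₂`, `Y`):
* `HodgeStructure.tmulFiltration G₁ G₂ p = Σ_{p ≤ a + b} im(G₁ a ⊗ G₂ b → Y₁ ⊗ Y₂)` — Deligne's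
  filtration on `Y₁ ⊗ Y₂` induced by two `ℤ`-indexed families of submodules (definition with body;
  the tree's `HodgeStructure.tensorFiltration` is its pull-back along the comparison
  `tensorBaseChange`, `tensorFiltration_eq_comap_tmulFiltration`), with its span description,
  functoriality (`map_tmulFiltration_le`), shift (`tmulFiltration_shift`), transport along
  equivalences (`tmulFiltration_comap_equiv`) and the CONCATENATION identity
  `μ (Fᵖ(Y^{⊗ a} ⊗ Y^{⊗ b})) = Fᵖ(Y^{⊗ (a + b)})` under Mathlib's
  `TensorPower.mulEquiv : Y^{⊗ a} ⊗ Y^{⊗ b} ≃ Y^{⊗ (a + b)}` (`map_mulEquiv_tmulFiltration`).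

Hodge structures:
* `Hom.tensorMap f g : Hom (H₁ ⊗ K₁) (H₂ ⊗ K₂)` — `(f, g) ↦ f ⊗ g` on morphisms (Deligne, Hodge II,
  1.1.12), with `Hom.tensorMap_retract` (retract pairs tensor);
* `Hom.congrF` — re-typing a morphism along termwise equal filtrations (same underlying map);
* `tensorFiltration_tateTwist` — `Fᵖ(H₁(c) ⊗ H₂(d)) = F^{p + c + d}(H₁ ⊗ H₂)`, i.e.
  `H₁(c) ⊗ H₂(d) = (H₁ ⊗ H₂)(c + d)` (Hodge II, 2.1.14);
* `comap_mulEquiv_tensorPowerFiltration` — `Fᵖ(H^{⊗ a} ⊗ H^{⊗ b})` is the pull-back of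
  `Fᵖ(H^{⊗ (a + b)})` along the complexification of `TensorPower.mulEquiv`, whence the mutually
  inverse morphisms of Hodge structures `Hom.tensorPowerMul H a b : H^{⊗ a} ⊗ H^{⊗ b} → H^{⊗ (a+b)}`
  and `Hom.tensorPowerMulSymm` (associativity of `⊗` of Hodge structures, "given by the usual
  constructions" on the underlying spaces).
-/

noncomputable section

open scoped TensorProduct

namespace Literature.AlgebraicGeometry.Motives

namespace HodgeStructure

/-! ### Deligne's filtration on a binary tensor product of filtered modules -/

section TmulFiltration

universe u v w

variable {R : Type u} [CommRing R] {Y₁ : Type v} [AddCommGroup Y₁] [Module R Y₁]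
  {Y₂ : Type w} [AddCommGroup Y₂] [Module R Y₂]

/-- **Deligne's filtration on `Y₁ ⊗ Y₂`** induced by `G₁ : ℤ → Submodule R Y₁` and
`G₂ : ℤ → Submodule R Y₂`: `Fᵖ(Y₁ ⊗ Y₂) = Σ_{p ≤ a + b} im(G₁ a ⊗ G₂ b → Y₁ ⊗ Y₂)` (with `p ≤ a + b`
rather than `=`, the same subspace for decreasing families, as in the tree's
`HodgeStructure.tensorFiltration`). [cite: DeligneHodgeII1971, 1.1.12] -/
def tmulFiltration (G₁ : ℤ → Submodule R Y₁) (G₂ : ℤ → Submodule R Y₂) (p : ℤ) :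
    Submodule R (Y₁ ⊗[R] Y₂) :=
  ⨆ (a : ℤ) (b : ℤ) (_ : p ≤ a + b), LinearMap.range (TensorProduct.mapIncl (G₁ a) (G₂ b))

/-- Span description: `Fᵖ(Y₁ ⊗ Y₂)` is spanned by the pure tensors `x ⊗ y` with `x ∈ G₁ a`,
`y ∈ G₂ b`, `p ≤ a + b`. [cite: DeligneHodgeII1971, 1.1.12] -/
theorem tmulFiltration_eq_span (G₁ : ℤ → Submodule R Y₁) (G₂ : ℤ → Submodule R Y₂) (p : ℤ) :
    tmulFiltration G₁ G₂ p = Submodule.span R {t | ∃ (a b : ℤ) (x : Y₁) (y : Y₂),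
      p ≤ a + b ∧ x ∈ G₁ a ∧ y ∈ G₂ b ∧ x ⊗ₜ[R] y = t} := by
  apply le_antisymm
  · refine iSup_le fun a => iSup_le fun b => iSup_le fun hab => ?_
    rw [TensorProduct.range_mapIncl, Submodule.map₂_le]
    intro x hx y hy
    exact Submodule.subset_span ⟨a, b, x, y, hab, hx, hy, rfl⟩
  · rw [Submodule.span_le]
    rintro _ ⟨a, b, x, y, hab, hx, hy, rfl⟩
    refine Submodule.mem_iSup_of_mem a (Submodule.mem_iSup_of_mem b
      (Submodule.mem_iSup_of_mem hab ?_))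
    exact ⟨⟨x, hx⟩ ⊗ₜ ⟨y, hy⟩, rfl⟩

/-- A pure tensor `x ⊗ y` with `x ∈ G₁ a`, `y ∈ G₂ b`, `p ≤ a + b` lies in `Fᵖ(Y₁ ⊗ Y₂)`.
[cite: DeligneHodgeII1971, 1.1.12] -/
theorem tmul_mem_tmulFiltration (G₁ : ℤ → Submodule R Y₁) (G₂ : ℤ → Submodule R Y₂) {p : ℤ}
    (a b : ℤ) (hab : p ≤ a + b) {x : Y₁} {y : Y₂} (hx : x ∈ G₁ a) (hy : y ∈ G₂ b) :
    x ⊗ₜ[R] y ∈ tmulFiltration G₁ G₂ p := by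
  rw [tmulFiltration_eq_span]
  exact Submodule.subset_span ⟨a, b, x, y, hab, hx, hy, rfl⟩

/-- The filtration `p ↦ Fᵖ(Y₁ ⊗ Y₂)` is decreasing. [cite: DeligneHodgeII1971, 1.1.12] -/
theorem tmulFiltration_antitone (G₁ : ℤ → Submodule R Y₁) (G₂ : ℤ → Submodule R Y₂) :
    Antitone (tmulFiltration G₁ G₂) :=
  fun _ _ h => iSup₂_mono fun _ _ => iSup_mono' fun hab => ⟨h.trans hab, le_rfl⟩

/-- **Functoriality** (Deligne, Hodge II, 1.1.12: `⊗` is a functor of filtered objects): linear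
maps `g₁ : Y₁ → Y₁'`, `g₂ : Y₂ → Y₂'` with `gᵢ (Gᵢ q) ⊆ Gᵢ' q` for all `q` induce
`g₁ ⊗ g₂ : Fᵖ(Y₁ ⊗ Y₂) → Fᵖ(Y₁' ⊗ Y₂')`. [cite: DeligneHodgeII1971, 1.1.12] -/
theorem map_tmulFiltration_le {Y₁' : Type*} [AddCommGroup Y₁'] [Module R Y₁'] {Y₂' : Type*}
    [AddCommGroup Y₂'] [Module R Y₂'] (G₁ : ℤ → Submodule R Y₁) (G₂ : ℤ → Submodule R Y₂)
    (G₁' : ℤ → Submodule R Y₁') (G₂' : ℤ → Submodule R Y₂') (g₁ : Y₁ →ₗ[R] Y₁')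
    (g₂ : Y₂ →ₗ[R] Y₂') (hg₁ : ∀ q, (G₁ q).map g₁ ≤ G₁' q) (hg₂ : ∀ q, (G₂ q).map g₂ ≤ G₂' q)
    (p : ℤ) :
    (tmulFiltration G₁ G₂ p).map (TensorProduct.map g₁ g₂) ≤ tmulFiltration G₁' G₂' p := by
  rw [tmulFiltration_eq_span, Submodule.map_span, Submodule.span_le]
  rintro _ ⟨_, ⟨a, b, x, y, hab, hx, hy, rfl⟩, rfl⟩
  rw [TensorProduct.map_tmul]
  exact tmul_mem_tmulFiltration G₁' G₂' a b hab (hg₁ _ ⟨x, hx, rfl⟩) (hg₂ _ ⟨y, hy, rfl⟩)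

/-- **Shift** (Tate twists on the factors): the filtration induced by `q ↦ G₁ (q + c)` and
`q ↦ G₂ (q + d)` is the filtration induced by `G₁`, `G₂` shifted by `c + d`: `Fᵖ = F^{p + c + d}`
(Deligne, Hodge II, 2.1.14: `H₁(c) ⊗ H₂(d) = (H₁ ⊗ H₂)(c + d)`).
[cite: DeligneHodgeII1971, 1.1.12 and 2.1.14] -/
theorem tmulFiltration_shift (G₁ : ℤ → Submodule R Y₁) (G₂ : ℤ → Submodule R Y₂) (c d p : ℤ) :
    tmulFiltration (fun q => G₁ (q + c)) (fun q => G₂ (q + d)) p =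
      tmulFiltration G₁ G₂ (p + c + d) := by
  apply le_antisymm
  · refine iSup_le fun a => iSup_le fun b => iSup_le fun hab => ?_
    exact le_iSup₂_of_le (a + c) (b + d) (le_iSup_of_le (by omega) le_rfl)
  · refine iSup_le fun a => iSup_le fun b => iSup_le fun hab => ?_
    refine le_iSup₂_of_le (a - c) (b - d) (le_iSup_of_le (by omega) ?_)
    rw [TensorProduct.range_mapIncl, TensorProduct.range_mapIncl]
    simp only [sub_add_cancel, le_refl]

/-- **Transport along linear equivalences** `e₁ : Y₁ ≃ Y₁'`, `e₂ : Y₂ ≃ Y₂'`: the filtration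
induced by the pulled-back families `q ↦ eᵢ⁻¹(Gᵢ' q)` is the pull-back along `e₁ ⊗ e₂` of the
filtration induced by `G₁'`, `G₂'`. [cite: DeligneHodgeII1971, 1.1.12] -/
theorem tmulFiltration_comap_equiv {Y₁' : Type*} [AddCommGroup Y₁'] [Module R Y₁']
    {Y₂' : Type*} [AddCommGroup Y₂'] [Module R Y₂'] (G₁' : ℤ → Submodule R Y₁')
    (G₂' : ℤ → Submodule R Y₂') (e₁ : Y₁ ≃ₗ[R] Y₁') (e₂ : Y₂ ≃ₗ[R] Y₂') (p : ℤ) :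
    tmulFiltration (fun q => (G₁' q).comap (e₁ : Y₁ →ₗ[R] Y₁'))
        (fun q => (G₂' q).comap (e₂ : Y₂ →ₗ[R] Y₂')) p =
      (tmulFiltration G₁' G₂' p).comap
        (TensorProduct.map (e₁ : Y₁ →ₗ[R] Y₁') (e₂ : Y₂ →ₗ[R] Y₂')) := by
  apply le_antisymm
  · rw [← Submodule.map_le_iff_le_comap]
    exact map_tmulFiltration_le _ _ _ _ _ _ (fun q => Submodule.map_comap_le _ _)
      (fun q => Submodule.map_comap_le _ _) p
  · intro z hz
    rw [Submodule.mem_comap] at hz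
    have hzz : TensorProduct.map (e₁.symm : Y₁' →ₗ[R] Y₁) (e₂.symm : Y₂' →ₗ[R] Y₂)
        (TensorProduct.map (e₁ : Y₁ →ₗ[R] Y₁') (e₂ : Y₂ →ₗ[R] Y₂') z) = z := by
      rw [← LinearMap.comp_apply, ← TensorProduct.map_comp]
      have h₁ : (e₁.symm : Y₁' →ₗ[R] Y₁) ∘ₗ (e₁ : Y₁ →ₗ[R] Y₁') = LinearMap.id :=
        LinearMap.ext fun y => e₁.symm_apply_apply y
      have h₂ : (e₂.symm : Y₂' →ₗ[R] Y₂) ∘ₗ (e₂ : Y₂ →ₗ[R] Y₂') = LinearMap.id :=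
        LinearMap.ext fun y => e₂.symm_apply_apply y
      rw [h₁, h₂, TensorProduct.map_id, LinearMap.id_apply]
    rw [← hzz]
    refine map_tmulFiltration_le G₁' G₂' _ _ (e₁.symm : Y₁' →ₗ[R] Y₁) (e₂.symm : Y₂' →ₗ[R] Y₂)
      (fun q => ?_) (fun q => ?_) p ⟨_, hz, rfl⟩
    · rintro _ ⟨y, hy, rfl⟩
      simpa using hy
    · rintro _ ⟨y, hy, rfl⟩
      simpa using hy

/-! ### Concatenation `Y^{⊗ a} ⊗ Y^{⊗ b} ≃ Y^{⊗ (a + b)}` identifies Deligne's filtrations -/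

variable {Y : Type v} [AddCommGroup Y] [Module R Y]

/-- `TensorPower.mulEquiv` concatenates pure tensors: `μ ((⊗ u) ⊗ (⊗ v)) = ⊗ (u ++ v)` (Mathlib's
`TensorPower.tprod_mul_tprod`, over any commutative ring; the tree's `mulEquiv_tprod_tmul_tprod`
is the field case). Private plumbing. [folklore] -/
private theorem mulEquiv_tprod_append {a b : ℕ} (u : Fin a → Y) (v : Fin b → Y) :
    TensorPower.mulEquiv (R := R) (M := Y)
        (PiTensorProduct.tprod R u ⊗ₜ[R] PiTensorProduct.tprod R v) =
      PiTensorProduct.tprod R (Fin.append u v) := by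
  rw [← TensorPower.gMul_def, TensorPower.tprod_mul_tprod]

/-- **Concatenation identifies Deligne's filtrations**: under Mathlib's
`μ = TensorPower.mulEquiv : Y^{⊗ a} ⊗ Y^{⊗ b} ≃ Y^{⊗ (a + b)}` (`(⊗ u) ⊗ (⊗ v) ↦ ⊗ (u ++ v)`),
`μ (Fᵖ(Y^{⊗ a} ⊗ Y^{⊗ b})) = Fᵖ(Y^{⊗ (a + b)})`, the former built from the filtrations
`q ↦ F^q(Y^{⊗ a})`, `q ↦ F^q(Y^{⊗ b})` of the factors: a multi-index `e : Fin (a + b) → ℤ` is a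
pair of multi-indices with `Σ e = Σ (e ∘ castAdd) + Σ (e ∘ natAdd)` (Deligne's
`Fᵖ(⊗ᵢ Vᵢ) = Σ_{Σ aᵢ ≥ p} ⊗ᵢ F^{aᵢ} Vᵢ` is associative in the evident sense; for `⊆` one
reduces to pure tensors by bilinearity, Mathlib's `Submodule.map₂_span_span`).
[cite: DeligneHodgeII1971, 1.1.12] -/
theorem map_mulEquiv_tmulFiltration (G : ℤ → Submodule R Y) (a b : ℕ) (p : ℤ) :
    (tmulFiltration (piTensorFiltration G (Fin a)) (piTensorFiltration G (Fin b)) p).map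
        (TensorPower.mulEquiv (R := R) (M := Y) (n := a) (m := b)).toLinearMap =
      piTensorFiltration G (Fin (a + b)) p := by
  apply le_antisymm
  · rw [tmulFiltration_eq_span, Submodule.map_span, Submodule.span_le]
    rintro _ ⟨_, ⟨s, t, x, y, hst, hx, hy, rfl⟩, rfl⟩
    rw [SetLike.mem_coe, LinearEquiv.coe_toLinearMap]
    -- reduce to pure tensors of the two factors by bilinearity
    set B : (⨂[R]^a Y) →ₗ[R] (⨂[R]^b Y) →ₗ[R] ⨂[R]^(a + b) Y :=
      (TensorProduct.mk R (⨂[R]^a Y) (⨂[R]^b Y)).compr₂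
        (TensorPower.mulEquiv (R := R) (M := Y) (n := a) (m := b)).toLinearMap with hB
    have hBxy : B x y = TensorPower.mulEquiv (x ⊗ₜ[R] y) := rfl
    rw [← hBxy]
    rw [piTensorFiltration_eq_span] at hx hy
    have hmem := Submodule.apply_mem_map₂ B hx hy
    rw [Submodule.map₂_span_span] at hmem
    refine (Submodule.span_le.mpr ?_) hmem
    rintro _ ⟨_, ⟨c, u, hc, hu, rfl⟩, _, ⟨d, v, hd, hv, rfl⟩, rfl⟩
    show TensorPower.mulEquiv (R := R) (M := Y)
      (PiTensorProduct.tprod R u ⊗ₜ[R] PiTensorProduct.tprod R v) ∈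
        piTensorFiltration G (Fin (a + b)) p
    rw [mulEquiv_tprod_append]
    refine tprod_mem_piTensorFiltration G (Fin.append c d) ?_ _ fun i => ?_
    · rw [Fin.sum_univ_add]
      simp only [Fin.append_left, Fin.append_right]
      omega
    · refine Fin.addCases (fun j => ?_) (fun j => ?_) i
      · simpa only [Fin.append_left] using hu j
      · simpa only [Fin.append_right] using hv j
  · rw [piTensorFiltration_eq_span G p, Submodule.span_le]
    rintro _ ⟨e, z, he, hz, rfl⟩
    refine ⟨PiTensorProduct.tprod R (fun i => z (Fin.castAdd b i)) ⊗ₜ[R]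
      PiTensorProduct.tprod R (fun j => z (Fin.natAdd a j)), ?_, ?_⟩
    · refine tmul_mem_tmulFiltration _ _ (∑ i, e (Fin.castAdd b i)) (∑ j, e (Fin.natAdd a j))
        ?_ ?_ ?_
      · rw [← Fin.sum_univ_add]; exact he
      · exact tprod_mem_piTensorFiltration G (fun i => e (Fin.castAdd b i)) le_rfl _
          fun i => hz _
      · exact tprod_mem_piTensorFiltration G (fun j => e (Fin.natAdd a j)) le_rfl _
          fun j => hz _
    · rw [LinearEquiv.coe_toLinearMap, mulEquiv_tprod_append, Fin.append_castAdd_natAdd]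

end TmulFiltration

/-! ### Hodge structures: `f ⊗ g`, twists, and `H^{⊗ a} ⊗ H^{⊗ b} ≅ H^{⊗ (a + b)}` -/

section Hodge

universe u₁ u₂ v₁ v₂

variable {V₁ : Type u₁} [AddCommGroup V₁] [Module ℚ V₁] {V₂ : Type u₂} [AddCommGroup V₂]
  [Module ℚ V₂] {W₁ : Type v₁} [AddCommGroup W₁] [Module ℚ W₁] {W₂ : Type v₂}
  [AddCommGroup W₂] [Module ℚ W₂]
variable {n m n' m' : ℤ}

/-- The tree's tensor filtration is Deligne's filtration `tmulFiltration H₁.F H₂.F` on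
`(ℂ ⊗ V) ⊗_ℂ (ℂ ⊗ W)` pulled back along the comparison isomorphism
`tensorBaseChange V W : ℂ ⊗ (V ⊗ W) ≃ (ℂ ⊗ V) ⊗_ℂ (ℂ ⊗ W)` (pull-backs along an isomorphism
commute with `Σ`). [cite: DeligneHodgeII1971, 1.1.12] -/
theorem tensorFiltration_eq_comap_tmulFiltration (H₁ : HodgeStructure V₁ n)
    (H₂ : HodgeStructure W₁ m) (p : ℤ) :
    H₁.tensorFiltration H₂ p =
      (tmulFiltration H₁.F H₂.F p).comap
        (tensorBaseChange V₁ W₁ : ℂ ⊗[ℚ] (V₁ ⊗[ℚ] W₁) →ₗ[ℂ] _) := by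
  rw [tensorFiltration, tmulFiltration]
  simp_rw [Submodule.comap_equiv_eq_map_symm, Submodule.map_iSup]

/-- `tensorBaseChange` is natural in pairs of linear maps (four universes):
`c ((f ⊗ g) ⊗ ℂ) = ((f ⊗ ℂ) ⊗ (g ⊗ ℂ)) c`. Private plumbing. [folklore] -/
private theorem tensorBaseChange_map_baseChange (f : V₁ →ₗ[ℚ] V₂) (g : W₁ →ₗ[ℚ] W₂)
    (x : ℂ ⊗[ℚ] (V₁ ⊗[ℚ] W₁)) :
    tensorBaseChange V₂ W₂ ((TensorProduct.map f g).baseChange ℂ x) =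
      TensorProduct.map (f.baseChange ℂ) (g.baseChange ℂ) (tensorBaseChange V₁ W₁ x) := by
  induction x using TensorProduct.induction_on with
  | zero => simp only [map_zero]
  | add x y hx hy => simp only [map_add, hx, hy]
  | tmul c z =>
    induction z using TensorProduct.induction_on with
    | zero => simp only [TensorProduct.tmul_zero, map_zero]
    | add x y hx hy => simp only [TensorProduct.tmul_add, map_add, hx, hy]
    | tmul v w =>
      simp only [LinearMap.baseChange_tmul, TensorProduct.map_tmul, tensorBaseChange_tmul]

/-- **`⊗` is a functor of filtered objects, on `ℚ`-Hodge structures:** if the complexifications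
of `f : V₁ → V₂` and `g : W₁ → W₂` map `Fᵖ H₁` into `Fᵖ H₂` and `Fᵖ K₁` into `Fᵖ K₂` for all `p`,
then the complexification of `f ⊗ g` maps `Fᵖ(H₁ ⊗ K₁)` into `Fᵖ(H₂ ⊗ K₂)`.
[cite: DeligneHodgeII1971, 1.1.12] -/
theorem map_tensorFiltration_le (H₁ : HodgeStructure V₁ n) (K₁ : HodgeStructure W₁ m)
    (H₂ : HodgeStructure V₂ n') (K₂ : HodgeStructure W₂ m') (f : V₁ →ₗ[ℚ] V₂) (g : W₁ →ₗ[ℚ] W₂)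
    (hf : ∀ q, (H₁.F q).map (f.baseChange ℂ) ≤ H₂.F q)
    (hg : ∀ q, (K₁.F q).map (g.baseChange ℂ) ≤ K₂.F q) (p : ℤ) :
    (H₁.tensorFiltration K₁ p).map ((TensorProduct.map f g).baseChange ℂ) ≤
      H₂.tensorFiltration K₂ p := by
  rw [tensorFiltration_eq_comap_tmulFiltration, tensorFiltration_eq_comap_tmulFiltration,
    Submodule.map_le_iff_le_comap]
  intro Z hZ
  rw [Submodule.mem_comap] at hZ
  rw [Submodule.mem_comap, Submodule.mem_comap, LinearEquiv.coe_coe,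
    tensorBaseChange_map_baseChange]
  exact map_tmulFiltration_le H₁.F K₁.F H₂.F K₂.F (f.baseChange ℂ) (g.baseChange ℂ) hf hg p
    ⟨_, hZ, rfl⟩

section TensorMap

variable [HodgeTensorFacts.{u₁, v₁}] [HodgeTensorFacts.{u₂, v₂}]

/-- **The tensor product of two morphisms of Hodge structures** `f : H₁ → H₂` (weight `n`) and
`g : K₁ → K₂` (weight `m`) is the morphism `f ⊗ g : H₁ ⊗ K₁ → H₂ ⊗ K₂` (weight `n + m`) with
underlying map Mathlib's `TensorProduct.map f g`: Deligne, Hodge II, 1.1.12 (`⊗` of filtered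
objects is functorial); Moonen §2.1 ("tensor products … given by the usual constructions"); Voisin
I Def. 11.39 with Def. 7.22. [cite: DeligneHodgeII1971, 1.1.12]
[cite: Moonen2017FamiliesMotives, §2.1 (p. 3)]
[cite: VoisinHodgeI2002, §11.3.3 Def. 11.39 (PDF p. 236)] -/
def Hom.tensorMap {H₁ : HodgeStructure V₁ n} {H₂ : HodgeStructure V₂ n} {K₁ : HodgeStructure W₁ m}
    {K₂ : HodgeStructure W₂ m} (f : Hom H₁ H₂) (g : Hom K₁ K₂) :
    Hom (H₁.tensor K₁) (H₂.tensor K₂) where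
  toLinearMap := TensorProduct.map f.toLinearMap g.toLinearMap
  map_F_le p := map_tensorFiltration_le H₁ K₁ H₂ K₂ f.toLinearMap g.toLinearMap f.map_F_le
    g.map_F_le p

/-- The underlying map of `f ⊗ g` is `TensorProduct.map f g`. [cite: DeligneHodgeII1971, 1.1.12] -/
@[simp]
theorem Hom.tensorMap_toLinearMap {H₁ : HodgeStructure V₁ n} {H₂ : HodgeStructure V₂ n}
    {K₁ : HodgeStructure W₁ m} {K₂ : HodgeStructure W₂ m} (f : Hom H₁ H₂) (g : Hom K₁ K₂) :
    (Hom.tensorMap f g).toLinearMap = TensorProduct.map f.toLinearMap g.toLinearMap :=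
  rfl

/-- **Retracts tensor**: if `r ∘ j = id` and `r' ∘ j' = id` then `(r ⊗ r') ∘ (j ⊗ j') = id`
(functoriality `(r ∘ j) ⊗ (r' ∘ j') = (r ⊗ r') ∘ (j ⊗ j')`, `id ⊗ id = id`).
[cite: DeligneHodgeII1971, 1.1.12] [cite: VoisinHodgeI2002, §7.3.1 Def. 7.22 (PDF p. 147)] -/
theorem Hom.tensorMap_retract {H₁ : HodgeStructure V₁ n} {H₂ : HodgeStructure V₂ n}
    {K₁ : HodgeStructure W₁ m} {K₂ : HodgeStructure W₂ m} (j : Hom H₁ H₂) (r : Hom H₂ H₁)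
    (hjr : ∀ v, r.toLinearMap (j.toLinearMap v) = v) (j' : Hom K₁ K₂) (r' : Hom K₂ K₁)
    (hjr' : ∀ w, r'.toLinearMap (j'.toLinearMap w) = w) (z : V₁ ⊗[ℚ] W₁) :
    (Hom.tensorMap r r').toLinearMap ((Hom.tensorMap j j').toLinearMap z) = z := by
  show TensorProduct.map r.toLinearMap r'.toLinearMap
    (TensorProduct.map j.toLinearMap j'.toLinearMap z) = z
  rw [← LinearMap.comp_apply, ← TensorProduct.map_comp]
  have h₁ : r.toLinearMap ∘ₗ j.toLinearMap = LinearMap.id := LinearMap.ext hjr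
  have h₂ : r'.toLinearMap ∘ₗ j'.toLinearMap = LinearMap.id := LinearMap.ext hjr'
  rw [h₁, h₂, TensorProduct.map_id, LinearMap.id_apply]

end TensorMap

/-- **Re-typing a morphism along termwise equal filtrations**: if `H₁'` has the same filtration as
`H₁` (same space; e.g. a transport `HodgeStructure.cast`, or `(T(c))(d)` versus `T(c + d)`) and
`H₂'` the same as `H₂`, a morphism `H₁ → H₂` is a morphism `H₁' → H₂'` with the same underlying
map (Voisin I Def. 7.22: being a morphism is a condition on the filtrations only).
[cite: VoisinHodgeI2002, §7.3.1 Def. 7.22 (PDF p. 147)] -/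
def Hom.congrF {H₁ : HodgeStructure V₁ n} {H₂ : HodgeStructure V₂ n} (φ : Hom H₁ H₂)
    {H₁' : HodgeStructure V₁ n'} {H₂' : HodgeStructure V₂ n'} (h₁ : ∀ p, H₁'.F p = H₁.F p)
    (h₂ : ∀ p, H₂'.F p = H₂.F p) : Hom H₁' H₂' where
  toLinearMap := φ.toLinearMap
  map_F_le p := by
    rw [h₁, h₂]
    exact φ.map_F_le p

/-- The underlying map of `Hom.congrF φ _ _` is that of `φ`.
[cite: VoisinHodgeI2002, §7.3.1 Def. 7.22 (PDF p. 147)] -/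
@[simp]
theorem Hom.congrF_toLinearMap {H₁ : HodgeStructure V₁ n} {H₂ : HodgeStructure V₂ n}
    (φ : Hom H₁ H₂) {H₁' : HodgeStructure V₁ n'} {H₂' : HodgeStructure V₂ n'}
    (h₁ : ∀ p, H₁'.F p = H₁.F p) (h₂ : ∀ p, H₂'.F p = H₂.F p) :
    (Hom.congrF φ h₁ h₂).toLinearMap = φ.toLinearMap :=
  rfl

/-- **Tensor products commute with Tate twists**: `Fᵖ(H₁(c) ⊗ H₂(d)) = F^{p + c + d}(H₁ ⊗ H₂)`,
i.e. `H₁(c) ⊗ H₂(d) = (H₁ ⊗ H₂)(c + d)` on the same space (Deligne, Hodge II, 2.1.14: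
`H(c) = H ⊗ ℚ(c)` and `ℚ(c) ⊗ ℚ(d) = ℚ(c + d)`). [cite: DeligneHodgeII1971, 2.1.13–2.1.14] -/
theorem tensorFiltration_tateTwist (H₁ : HodgeStructure V₁ n) (H₂ : HodgeStructure W₁ m)
    (c d p : ℤ) :
    (H₁.tateTwist c).tensorFiltration (H₂.tateTwist d) p = H₁.tensorFiltration H₂ (p + c + d) := by
  rw [tensorFiltration_eq_comap_tmulFiltration, tensorFiltration_eq_comap_tmulFiltration]
  have h₁ : (H₁.tateTwist c).F = fun q ↦ H₁.F (q + c) := rfl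
  have h₂ : (H₂.tateTwist d).F = fun q ↦ H₂.F (q + d) := rfl
  rw [h₁, h₂, tmulFiltration_shift]

/-! ### `H^{⊗ a} ⊗ H^{⊗ b} ≅ H^{⊗ (a + b)}` is an isomorphism of Hodge structures -/

/-- **Base-change square for the concatenation**: after complexification and the comparison maps
(`piTensorBaseChange` on `V^{⊗ (a + b)}`; `tensorBaseChange` then `piTensorBaseChange` on each
factor of `V^{⊗ a} ⊗ V^{⊗ b}`), the `ℚ`-concatenation `TensorPower.mulEquiv` on `V` becomes the
`ℂ`-concatenation on `ℂ ⊗ V` (both sides agree on `c ⊗ ((⊗ u) ⊗ (⊗ v))`, which span). Private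
plumbing. [folklore] -/
private theorem piTensorBaseChange_mulEquiv_baseChange (a b : ℕ)
    (Z : ℂ ⊗[ℚ] ((⨂[ℚ]^a V₁) ⊗[ℚ] (⨂[ℚ]^b V₁))) :
    piTensorBaseChange V₁ (Fin (a + b))
        ((TensorPower.mulEquiv (R := ℚ) (M := V₁) (n := a) (m := b)).toLinearMap.baseChange ℂ Z) =
      TensorPower.mulEquiv (R := ℂ) (M := ℂ ⊗[ℚ] V₁) (n := a) (m := b)
        (TensorProduct.map (piTensorBaseChange V₁ (Fin a)) (piTensorBaseChange V₁ (Fin b))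
          (tensorBaseChange (⨂[ℚ]^a V₁) (⨂[ℚ]^b V₁) Z)) := by
  induction Z using TensorProduct.induction_on with
  | zero => simp only [map_zero]
  | add x y hx hy => simp only [map_add, hx, hy]
  | tmul c z =>
    induction z using TensorProduct.induction_on with
    | zero => simp only [TensorProduct.tmul_zero, map_zero]
    | add x y hx hy => simp only [TensorProduct.tmul_add, map_add, hx, hy]
    | tmul x y =>
      induction x using PiTensorProduct.induction_on with
      | add x x' hx hx' => simp only [TensorProduct.add_tmul, TensorProduct.tmul_add, map_add, hx, hx']
      | smul_tprod r u =>
        induction y using PiTensorProduct.induction_on with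
        | add y y' hy hy' => simp only [TensorProduct.tmul_add, map_add, hy, hy']
        | smul_tprod s v =>
          rw [TensorProduct.smul_tmul_smul, TensorProduct.tmul_smul, TensorProduct.smul_tmul']
          generalize (r * s) • c = d
          rw [LinearMap.baseChange_tmul, LinearEquiv.coe_coe, mulEquiv_tprod_append,
            piTensorBaseChange_tmul_tprod, tensorBaseChange_tmul, TensorProduct.map_tmul,
            piTensorBaseChange_tmul_tprod, piTensorBaseChange_tmul_tprod, one_smul,
            ← TensorProduct.smul_tmul', map_smul, mulEquiv_tprod_append, append_comp_apply]

/-- **The concatenation is an isomorphism of Hodge structures `H^{⊗ a} ⊗ H^{⊗ b} ≅ H^{⊗ (a + b)}`,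
on filtrations:** `Fᵖ(H^{⊗ a} ⊗ H^{⊗ b})` is the pull-back of `Fᵖ(H^{⊗ (a + b)})` along the
complexification of `TensorPower.mulEquiv` — Deligne's filtration of a tensor product of tensor
powers is the filtration of the concatenated tensor power (`Fᵖ((⊗_{i<a} V) ⊗ (⊗_{j<b} V)) =
Σ ⊗ F^{aᵢ} ⊗ F^{bⱼ}` over `Σ aᵢ + Σ bⱼ ≥ p`, Hodge II 1.1.12), read through the comparison maps
(`piTensorBaseChange_mulEquiv_baseChange`, `map_mulEquiv_tmulFiltration`,
`tmulFiltration_comap_equiv`). [cite: DeligneHodgeII1971, 1.1.12] -/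
theorem comap_mulEquiv_tensorPowerFiltration [HodgeTensorFacts.{u₁, u₁}] (H : HodgeStructure V₁ n)
    (a b : ℕ) (p : ℤ) :
    (H.tensorPowerFiltration (a + b) p).comap
        ((TensorPower.mulEquiv (R := ℚ) (M := V₁) (n := a) (m := b)).toLinearMap.baseChange ℂ) =
      (H.tensorPower a).tensorFiltration (H.tensorPower b) p := by
  -- the comparison isomorphisms on the factors
  set ca := LinearEquiv.ofBijective _ (piTensorBaseChange_bijective V₁ (Fin a)) with hca_def
  have hca : (ca : _ →ₗ[ℂ] _) = piTensorBaseChange V₁ (Fin a) := LinearMap.ext fun _ ↦ rfl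
  set cb := LinearEquiv.ofBijective _ (piTensorBaseChange_bijective V₁ (Fin b)) with hcb_def
  have hcb : (cb : _ →ₗ[ℂ] _) = piTensorBaseChange V₁ (Fin b) := LinearMap.ext fun _ ↦ rfl
  set cab := LinearEquiv.ofBijective _ (piTensorBaseChange_bijective V₁ (Fin (a + b)))
    with hcab_def
  have hcab : (cab : _ →ₗ[ℂ] _) = piTensorBaseChange V₁ (Fin (a + b)) :=
    LinearMap.ext fun _ ↦ rfl
  have hFa : (H.tensorPower a).F = fun q ↦ (piTensorFiltration H.F (Fin a) q).comap (ca : _ →ₗ[ℂ] _) := by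
    funext q
    rw [tensorPower_F, tensorPowerFiltration_eq_comap_piTensorFiltration, hca]
  have hFb : (H.tensorPower b).F = fun q ↦ (piTensorFiltration H.F (Fin b) q).comap (cb : _ →ₗ[ℂ] _) := by
    funext q
    rw [tensorPower_F, tensorPowerFiltration_eq_comap_piTensorFiltration, hcb]
  rw [tensorFiltration_eq_comap_tmulFiltration, hFa, hFb, tmulFiltration_comap_equiv,
    tensorPowerFiltration_eq_comap_piTensorFiltration, ← map_mulEquiv_tmulFiltration H.F a b p,
    Submodule.map_equiv_eq_comap_symm]
  ext Z
  simp only [Submodule.mem_comap, LinearEquiv.coe_coe, hca, hcb]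
  rw [piTensorBaseChange_mulEquiv_baseChange, LinearEquiv.symm_apply_apply]

section MulHom

variable [HodgeTensorFacts.{u₁, u₁}]

/-- **The concatenation morphism of Hodge structures `H^{⊗ a} ⊗ H^{⊗ b} → H^{⊗ (a + b)}`** (weights
matched by `HodgeStructure.cast`), underlying map `TensorPower.mulEquiv`,
`(⊗ u) ⊗ (⊗ v) ↦ ⊗ (u ++ v)`; with `Hom.tensorPowerMulSymm` an isomorphism (associativity of the
tensor product of Hodge structures, "given by the usual constructions" on the underlying spaces).
[cite: DeligneHodgeII1971, 1.1.12] [cite: Moonen2017FamiliesMotives, §2.1 (p. 3)] -/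
def Hom.tensorPowerMul (H : HodgeStructure V₁ n) (a b : ℕ) :
    Hom ((H.tensorPower a).tensor (H.tensorPower b))
      ((H.tensorPower (a + b)).cast (by push_cast; ring)) :=
  Hom.ofComapBaseChange (TensorPower.mulEquiv (R := ℚ) (M := V₁) (n := a) (m := b)) fun p ↦
    comap_mulEquiv_tensorPowerFiltration H a b p

/-- The underlying map of `Hom.tensorPowerMul`. [cite: DeligneHodgeII1971, 1.1.12]
[cite: VoisinHodgeI2002, §11.3.3 Def. 11.39 (PDF p. 236)] -/
@[simp]
theorem Hom.tensorPowerMul_toLinearMap (H : HodgeStructure V₁ n) (a b : ℕ) :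
    (Hom.tensorPowerMul H a b).toLinearMap =
      (TensorPower.mulEquiv (R := ℚ) (M := V₁) (n := a) (m := b)).toLinearMap :=
  rfl

/-- **The splitting morphism of Hodge structures `H^{⊗ (a + b)} → H^{⊗ a} ⊗ H^{⊗ b}`**, underlying
map `(TensorPower.mulEquiv)⁻¹` (inverse of `Hom.tensorPowerMul`).
[cite: DeligneHodgeII1971, 1.1.12] [cite: Moonen2017FamiliesMotives, §2.1 (p. 3)] -/
def Hom.tensorPowerMulSymm (H : HodgeStructure V₁ n) (a b : ℕ) :
    Hom ((H.tensorPower (a + b)).cast (by push_cast; ring))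
      ((H.tensorPower a).tensor (H.tensorPower b)) :=
  Hom.symmOfComapBaseChange (TensorPower.mulEquiv (R := ℚ) (M := V₁) (n := a) (m := b)) fun p ↦
    comap_mulEquiv_tensorPowerFiltration H a b p

/-- The underlying map of `Hom.tensorPowerMulSymm`. [cite: DeligneHodgeII1971, 1.1.12]
[cite: VoisinHodgeI2002, §11.3.3 Def. 11.39 (PDF p. 236)] -/
@[simp]
theorem Hom.tensorPowerMulSymm_toLinearMap (H : HodgeStructure V₁ n) (a b : ℕ) :
    (Hom.tensorPowerMulSymm H a b).toLinearMap =
      (TensorPower.mulEquiv (R := ℚ) (M := V₁) (n := a) (m := b)).symm.toLinearMap :=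
  rfl

/-- `split ∘ concat = id` on `H^{⊗ a} ⊗ H^{⊗ b}`: the concatenation is an isomorphism of Hodge
structures. [cite: DeligneHodgeII1971, 1.1.12]
[cite: VoisinHodgeI2002, §11.3.3 Def. 11.39 (PDF p. 236)] -/
theorem Hom.tensorPowerMulSymm_tensorPowerMul_apply (H : HodgeStructure V₁ n) (a b : ℕ)
    (x : (⨂[ℚ]^a V₁) ⊗[ℚ] (⨂[ℚ]^b V₁)) :
    (Hom.tensorPowerMulSymm H a b).toLinearMap ((Hom.tensorPowerMul H a b).toLinearMap x) = x :=
  (TensorPower.mulEquiv (R := ℚ) (M := V₁) (n := a) (m := b)).symm_apply_apply x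

/-- `concat ∘ split = id` on `H^{⊗ (a + b)}`. [cite: DeligneHodgeII1971, 1.1.12]
[cite: VoisinHodgeI2002, §11.3.3 Def. 11.39 (PDF p. 236)] -/
theorem Hom.tensorPowerMul_tensorPowerMulSymm_apply (H : HodgeStructure V₁ n) (a b : ℕ)
    (x : ⨂[ℚ]^(a + b) V₁) :
    (Hom.tensorPowerMul H a b).toLinearMap ((Hom.tensorPowerMulSymm H a b).toLinearMap x) = x :=
  (TensorPower.mulEquiv (R := ℚ) (M := V₁) (n := a) (m := b)).apply_symm_apply x

end MulHom

end Hodge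

end HodgeStructure

end Literature.AlgebraicGeometry.Motives
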